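import Mathlib
import Summits.Ventures.PercRepro2.HCovTyped
import Summits.Ventures.PercRepro2.TypedSplit

/-!
# (ROW-23), contraction monotonicity of the type-2 base, and the reduction of row 2′TRI to the
all-type-1 instances (blind cell PercRepro2, night-3 g19, 2026-08-28; `proofs/NIGHT3-CERT.md` §28.5)

CANDIDATE (ROW-23), NOT claimed proved: for every typed edge `g` of type `2`, the typed base
dominates the typed base with `g` pinned OPEN — along every edge the Bernstein row
`(N₀, N₁, N₂, N₃)` of the typed counts has `N₂ ≥ N₃`. Census (exact): `N₂ < N₃` on 0 rows of the
exhaustive row census of every abstract instance with `≤ 6` typed edges (22,296,160 rows at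
`a = 5`, ≈ 461 M at `a = 6`, every marking; g18's data, the field read off by this seat) and on
0 of 295,403 nonzero rows of 2.7 M random instances with `≤ 10` typed edges (this seat's code).

WHAT IT GIVES in the kernel, unconditionally on the candidate: a type-`3` edge is the minor with the
edge pinned open (`typedCount_type_three`), so (ROW-23) is an INDUCTION — every type-`2` edge
contracts away, and

* `typedBases_of_row23`: **row 2′TRI on every instance ⟸ (ROW-23) ∧ row 2′TRI on the instances whose
  typed edges are ALL of type `1`** (`TypedBasesOne`);
* `typedCount_nonneg_of_row23_minor`: the single induction step.

`Row23` and `TypedBasesOne` are `def`s (Props); the theorems are conditional on them. Own work;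
standard axioms.
-/

namespace Summit.Ventures.PercRepro2

open UnionCluster

namespace CovForm

section Defs

variable {V : Type*} {E : Type*} [Fintype E] [DecidableEq E] {R : Type*} [Field R]
  [LinearOrder R] [IsStrictOrderedRing R]

/-- **(ROW-23), a CANDIDATE (not claimed proved)**: with `g ∈ F` of type `2` (types in `{1, 2}` on
`F`), pinning `g` open (type `3`) does not increase the typed base of `K₃`. -/
def Row23 (ends : E → Sym2 V) (o a₁ a₂ a₃ b : V) : Prop :=
  ∀ (F : Finset E) (z : Config E) (τ : E → ℕ) (g : E), g ∈ F → τ g = 2 →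
    (∀ e ∈ F, τ e = 1 ∨ τ e = 2) →
    typedCount F z (Function.update τ g 3)
        (K3 ends o a₁ a₂ a₃ b : Config E → Config E → Config E → R) ≤
      typedCount F z τ (K3 ends o a₁ a₂ a₃ b)

/-- **Row 2′TRI on the all-type-`1` instances**: every typed count of `K₃` with every typed edge of
type `1` is nonnegative. -/
def TypedBasesOne (ends : E → Sym2 V) (o a₁ a₂ a₃ b : V) : Prop :=
  ∀ (F : Finset E) (z : Config E) (τ : E → ℕ), (∀ e ∈ F, τ e = 1) →
    0 ≤ typedCount F z τ (K3 ends o a₁ a₂ a₃ b : Config E → Config E → Config E → R)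

end Defs

namespace Row23Red

open TypedRed

section Main

variable {V : Type*} {E : Type*} [Fintype E] [DecidableEq E] {R : Type*} [Field R]
  [LinearOrder R] [IsStrictOrderedRing R]
variable (ends : E → Sym2 V) (o a₁ a₂ a₃ b : V)

omit [LinearOrder R] [IsStrictOrderedRing R] in
/-- A type-`3` edge is the contraction: the count with `g` of type `3` is the count on `F.erase g`
with `g` pinned open. -/
lemma typedCount_update_three (F : Finset E) (g : E) (hg : g ∈ F) (z : Config E) (τ : E → ℕ)
    (K : Config E → Config E → Config E → R) :
    typedCount F z (Function.update τ g 3) K =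
      typedCount (F.erase g) (Function.update z g true) τ K := by
  rw [typedCount_type_three F g hg z (Function.update τ g 3) (Function.update_self _ _ _) K]
  exact typedCount_congr_τ (F.erase g) _ (fun e he => Function.update_of_ne (Finset.ne_of_mem_erase he) _ _) K

omit [IsStrictOrderedRing R] in
/-- **The induction step of (ROW-23)**: if the contracted instance `G / g` (g pinned open, one typed
edge fewer) has a nonnegative typed base, so has the instance with `g` of type `2`. -/
theorem typedCount_nonneg_of_row23_minor (h23 : Row23 (R := R) ends o a₁ a₂ a₃ b) (F : Finset E)
    (z : Config E) (τ : E → ℕ) (g : E) (hg : g ∈ F) (hg2 : τ g = 2)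
    (hτ : ∀ e ∈ F, τ e = 1 ∨ τ e = 2)
    (hmin : 0 ≤ typedCount (F.erase g) (Function.update z g true) τ
      (K3 ends o a₁ a₂ a₃ b : Config E → Config E → Config E → R)) :
    0 ≤ typedCount F z τ (K3 ends o a₁ a₂ a₃ b : Config E → Config E → Config E → R) := by
  have h := h23 F z τ g hg hg2 hτ
  rw [typedCount_update_three F g hg z τ] at h
  exact le_trans hmin h

omit [IsStrictOrderedRing R] in
/-- **Row 2′TRI from (ROW-23) and the all-type-`1` instances**: every type-`2` edge contracts away
(induction on the typed set), and what remains has every typed edge of type `1`. -/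
theorem typedBases_of_row23 (h23 : Row23 (R := R) ends o a₁ a₂ a₃ b)
    (h1 : TypedBasesOne (R := R) ends o a₁ a₂ a₃ b) : TypedBases (R := R) ends o a₁ a₂ a₃ b := by
  intro F
  induction F using Finset.strongInduction with
  | H F ih =>
    intro z τ hτ
    by_cases h2 : ∃ g ∈ F, τ g = 2
    · obtain ⟨g, hg, hg2⟩ := h2
      exact typedCount_nonneg_of_row23_minor ends o a₁ a₂ a₃ b h23 F z τ g hg hg2 hτ
        (ih (F.erase g) (Finset.erase_ssubset hg) (Function.update z g true) τ
          (fun e he => hτ e (Finset.mem_of_mem_erase he)))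
    · exact h1 F z τ fun e he => (hτ e he).resolve_right fun h => h2 ⟨e, he, h⟩

/-- **(HCOV) from (ROW-23) and the all-type-`1` instances**, for every admissible weight vector. -/
theorem HCov_of_row23 (h23 : Row23 (R := R) ends o a₁ a₂ a₃ b)
    (h1 : TypedBasesOne (R := R) ends o a₁ a₂ a₃ b) (p : E → R) (hp : IsProbVec p) :
    HCov p ends o a₁ a₂ a₃ b :=
  HCov_of_typedBases ends o a₁ a₂ a₃ b (typedBases_of_row23 ends o a₁ a₂ a₃ b h23 h1) p hp

end Main

end Row23Red

end CovForm

end Summit.Ventures.PercRepro2
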